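import Literature.Geometry.Kaehler.ComplexTorusKleimanFormsHodgeClasses
import Literature.Geometry.Kaehler.ComplexTorusAndreHodgeInvolution
import HarnessLib

/-!
# André's form `K_H(x, y) = B_e(x, *_H y)` on the cohomology of a complex torus: it IS his printed `∫ x ∪ *_H y` up to the orientation sign, Voisin's
# Weyl polarization up to `sign_X(e)·(−1)^g`; `L_η ↔ Λ_η` transpose for it; `(−1)ᵏ`-symmetric, non-degenerate, `ℚ`-valued, Lefschetz-ORTHOGONAL with
# `K_H = (j!/(n−j)!)·K_∗ = (−1)^{m(m+1)/2}(j!/(n−j)!)·K_L` on `Lʲ Pᵐ`; and ANDRÉ'S POSITIVITY: `sign_X(e)(−1)^g K_H(x, x) > 0` on the non-zero real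
# `(p,p)`-classes — `K_H` is ANISOTROPIC on `Hdgᵖ(X)` with positive rational values, and on `Lʲ P^{2p−2j}` the sign of `K_L(x, x)` is `sign_X(e)(−1)^{g+p+j}`

Layer `Literature/Geometry/Kaehler`, namespace `Literature.Geometry.Kaehler.ComplexTorus`; lane `lit-hodgefound` (Track 2 foundations library),
prover seat `lit-hodgefound-p35` (generation 51, row g51-#5; sequel of rows g51-#1 `ComplexTorusGradedPoincarePairing` — `B_e = poincarePairingG Φ e` —,
g51-#2 `ComplexTorusKleimanForms` — `K_L = B_e.compl₂ *_L`, `K_∗ = B_e.compl₂ ∗` —, g51-#3 `ComplexTorusKleimanFormsHodgeClasses`, and of row g49-#3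
`ComplexTorusAndreHodgeInvolution` — André's `*_H` on the torus, `*_H = (−1)^{g + n(n−1)/2} w` on `Hⁿ`, and `(−1)^g ∫_X x ∧ *_H x > 0` on real `(p,p)`-classes).
THEOREMS ONLY (no definition, no named fact, no instance, no notation; D-0026 net debt `0`).

THE OBJECT. `K_H := (poincarePairingG Φ e).compl₂ *_H`, `*_H = (hasLefschetzProperty_lefschetzG hη).andreHodgeInvolution isZGrading_countingG d` André's Hodge
involution WITH ITS FACTORIALS (`*_H(Lʲχ) = (−1)^{m(m+1)/2} (j!/(n−j)!) L^{n−j}χ` for `χ ∈ Pᵐ`, `m + n = d`), i.e. André's "forme bilinéaire `(x, y) ↦ ∫ x ∪ *_H y`"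
read through the tree's Poincaré pairing `B_e` (which differs from `∫_X` by the orientation sign `sign_X(e) = orientationSign Φ e ∈ {±1}` of the lattice basis `e`).

## What is proved (`X = E/Λ`, `g = dim_ℂ E`, `η` non-degenerate, `e : Fin N ≃ ι` so `N = 2g`; `K_H = (poincarePairingG Φ e).compl₂ *_H`)

* §1 EVALUATION AND IDENTIFICATION: `andreHodgeInvolution_of_eq_of'` (`*_H : Hᵏ → H^{2g−k}`, any normalisation `d`), `compl₂_andreHodgeInvolution_of_of`
  (`K_H(of k x, of k y) = ⟨x, (*_H y)_m⟩_e`), `…_of_of_of_ne` (different degrees are `K_H`-orthogonal), `compl₂_andreHodgeInvolution_apply_andreHodgeInvolution`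
  (`K_H(w, *_H w') = B(w, w')`), `isOrthogonal_poincarePairingG_andreHodgeInvolution` (`*_H` is a `B`-isometry), `compl₂_andreHodgeInvolution_andreHodgeInvolution_apply`,
  `isSelfAdjoint_compl₂_andreHodgeInvolution_andreHodgeInvolution` (`*_H` is `K_H`-self-adjoint);
  **`compl₂_andreHodgeInvolution_of_of_eq_orientationSign_mul_torusIntegral`: `K_H(of k x, of k y) = sign_X(e) · ∫_X x ∧ *_H(y)`** (ANDRÉ'S PRINTED FORM),
  **`compl₂_andreHodgeInvolution_of_of_eq_orientationSign_mul_weylPairing`: `K_H(of k x, of k y) = sign_X(e)(−1)^g(−1)^{k(k−1)/2} B_k^w(x, y)`**, and on `Hᵏ(X; ℚ)`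
  **`coe_weylPolarizationForm_eq_orientationSign_mul_compl₂_andreHodgeInvolution`: `Q_w(γ, δ) = sign_X(e)(−1)^g K_H(of γ, of δ)`** (Voisin's Weyl polarization form of
  rows g48-#2/#3 IS André's `K_H` up to the sign `sign_X(e)(−1)^g`), `IsRiemannForm.coe_weylPolarization_form_eq_orientationSign_mul_compl₂_andreHodgeInvolution`.
* §2 TRANSPOSITION (André's Prop. 1.2, last clause, for `* = *_H`): `isAdjointPair_compl₂_andreHodgeInvolution_of_isAdjointPair` (the `K_H`-transpose of `T` is
  `*_H Tᵗ *_H`), **`isAdjointPair_compl₂_andreHodgeInvolution_lefschetzG_lefschetzDualG`: `K_H(L_η w, w') = K_H(w, Λ_η w')`** and `…_lefschetzDualG_lefschetzG`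
  ("ces générateurs s'échangent par la transposition" — ON THE NOSE for `*_H`, where `*_L` only gives `ᶜL`), `isSelfAdjoint_compl₂_andreHodgeInvolution_countingG`
  (`H` is `K_H`-symmetric), `isAdjointPair_compl₂_andreHodgeInvolution_sl2Rep_transpose` (`ρ(γ)ᵀ = ρ(γᵀ)` for every `γ ∈ SL₂(ℂ)`),
  `isOrthogonal_compl₂_andreHodgeInvolution_weylOperator` / `…_sl2Rep_of_transpose_mul_self` (`w` and `SO₂` act by `K_H`-isometries),
  `isSelfAdjoint_compl₂_andreHodgeInvolution_of_mem_adjoin_pair_of_commute` (the degree-`0` part of `ℂ[L_η, Λ_η]` — the Lefschetz–Künneth projectors — is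
  `K_H`-symmetric), `exists_mem_adjoin_isAdjointPair_compl₂_andreHodgeInvolution` (`ℂ[L_η, Λ_η]` is stable under `K_H`-transposition).
* §3 SYMMETRY, NON-DEGENERACY, `ℚ`-VALUES: `compl₂_andreHodgeInvolution_apply_of_comm` (`K_H(w, of k x) = (−1)ᵏ K_H(of k x, w)`), `…_of_of_comm`,
  `compl₂_andreHodgeInvolution_nondegenerate`, `eq_zero_of_forall_compl₂_andreHodgeInvolution_of_of_eq_zero` (non-degenerate on each `Hᵏ`),
  `compl₂_andreHodgeInvolution_mem_range_rat` (`K_H(H•(X;ℚ), H•(X;ℚ)) ⊆ ℚ` for `η ∈ NS(X) ⊗ ℚ`), `compl₂_andreHodgeInvolution_of_of_mem_range_rat_of_mem_hodgeClasses`.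
* §4 AGAINST THE LEFSCHETZ DECOMPOSITION: `compl₂_andreHodgeInvolution_of_lefschetzPow_of_lefschetzPow_eq_zero` (strings of different length or position are
  `K_H`-orthogonal), `compl₂_andreHodgeInvolution_of_of_eq_zero_of_mem_lefschetzSummandForms` (`Lʲ P^{a−2j} ⊥_{K_H} L^{j'} P^{a−2j'}`, `j ≠ j'`),
  **`compl₂_andreHodgeInvolution_of_lefschetzPow_of_lefschetzPow`: `K_H(of a (Lʲχ), of a (Lʲχ')) = (−1)^{m(m+1)/2} (j!/(n−j)!) ⟨Lⁿχ, χ'⟩_e`**,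
  **`compl₂_andreHodgeInvolution_apply_of_eq_mul_compl₂_hodgeInvolution_apply_of`: `K_H(w, y) = (j!/(n−j)!) K_∗(w, y)`** and
  **`compl₂_andreHodgeInvolution_apply_of_eq_mul_compl₂_lefschetzInvolution_apply_of`: `K_H(w, y) = (−1)^{m(m+1)/2}(j!/(n−j)!) K_L(w, y)`** for `y ∈ Lʲ Pᵐ`, every `w`.
* §5 HODGE TYPES: `compl₂_andreHodgeInvolution_of_of_eq_zero_of_mem_typeSubmodule` (`H^{p,q} ⊥_{K_H} H^{p',q'}` unless `p' = q`).
* §6 ANDRÉ'S POSITIVITY ("cet opérateur star et `*_H` ont les mêmes propriétés de positivité sur les cycles réels de type `(p,p)`"), `η` a Kähler datum, `e : Fin (2g) ≃ ι`: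
  **`exists_pos_orientationSign_mul_compl₂_andreHodgeInvolution_of_of_self`: `sign_X(e)(−1)^g K_H(of x, of x) = c > 0`** for `x ≠ 0` real of type `(p,p)`, EVERY `p`
  (no degree hypothesis); `compl₂_andreHodgeInvolution_of_of_self_eq_zero_iff` (`K_H` IS ANISOTROPIC on the real `(p,p)`-classes); for a Riemann form
  `IsRiemannForm.exists_pos_orientationSign_mul_compl₂_andreHodgeInvolution_of_of_self`, **`IsRiemannForm.exists_pos_rat_orientationSign_mul_compl₂_andreHodgeInvolution_of_mem_hodgeClasses`**
  (`sign_X(e)(−1)^g K_H(x, x) ∈ ℚ_{>0}` on `Hdgᵖ(X) ∖ 0`), **`IsRiemannForm.compl₂_andreHodgeInvolution_of_of_self_eq_zero_iff_of_mem_hodgeClasses`** (`K_H` IS ANISOTROPIC ON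
  `Hdgᵖ(X)`); and THE SIGN OF KLEIMAN'S FORMS ON A LEFSCHETZ SUMMAND: **`exists_pos_orientationSign_mul_compl₂_hodgeInvolution_of_of_self_of_mem_lefschetzSummandForms`**
  (`sign_X(e)(−1)^g K_∗(x, x) > 0` on `Lʲ P^{2p−2j} ∩ H^{p,p}_ℝ`: Kleiman's `∗` has André's sign summand by summand) and
  **`exists_pos_orientationSign_mul_compl₂_lefschetzInvolution_of_of_self_of_mem_lefschetzSummandForms`: `sign_X(e)(−1)^{g+p+j} K_L(x, x) > 0`** there — the sign of
  `B(x, *_L x)` ALTERNATES with the Lefschetz position `j`, which is André's reason for introducing `*_H` ("l'intérêt de l'introduction de `*_H`").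

## Sources, VERBATIM

* Y. André, *Pour une théorie inconditionnelle des motifs*, Publ. Math. IHÉS **83** (1996) [Andre1996Motifs] (held `paper:doi-10-1007-bf02698643`, p0007–p0009 =
  pp. 10–12), §1.1 (p. 10): "`*_H x = Σ (−1)^{(j−2k)(j−2k+1)/2} (k!/(d−j+k)!) L^{d−j+k} x_{j−2k}`"; §1.1 Remarque (p. 11): "l'intérêt de l'introduction de `*_H` est
  que cet opérateur star et `*_H` ont les mêmes propriétés de positivité sur les cycles réels de type `(p,p)` […] Remarquons aussi que `L`, `*_L`, `*_H` et `ᶜΛ`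
  sont auto-adjoints relativement à l'accouplement de dualité de Poincaré `(x, y) ↦ ∫ x ∪ y`."; Prop. 1.2 (p. 11): "On a un isomorphisme canonique d'algèbres
  […] la transposition relative à la forme bilinéaire `(x, y) ↦ ∫ x ∪ *y` correspond à la transposition des matrices, pour `* = *_L` ou `*_H`."; proof (p. 12):
  "ces générateurs s'échangent par la transposition".
* S. L. Kleiman, *Algebraic cycles and the Weil conjectures* (1968) [Kleiman1968AlgebraicCycles], §1.4 (the operators `⋆`, `pʲ`, 1.4.2–1.4.4) and §3 (Hodge index / positivity
  of `⟨x, ⋆x⟩` up to sign on primitive pieces).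
* C. Voisin, *Hodge Theory and Complex Algebraic Geometry I* (CUP 2002) [VoisinHodgeI2002], §6.3.2 Thm. 6.32 (Hodge–Riemann bilinear relations), §7.1.2 Def. 7.7 (PDF p. 134).
* J. S. Milne, *Lefschetz classes on abelian varieties*, Duke Math. J. **96** (1999) [Milne1999LefschetzClasses], §5 p. 664 (`∗`, the sums `Σ_{i ≥ s−d}`).
* H. Lange, *Abelian Varieties over the Complex Numbers* (2023) [Lange2023AbelianVarietiesComplex], §1.7.2 Lemmas 1.7.4–1.7.5 (`c₁(L) = −E`, the sign `(−1)^g`), §5.4.1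
  Lemma 5.4.3 (d), §7.2.2 (Hodge classes).
-/

namespace Literature.Geometry.Kaehler

namespace ComplexTorus

open Module Function Finset
open Literature.LinearAlgebra.Alternating Literature.Algebra.Lie Literature.Analysis.Complex
open scoped MatrixGroups Nat

set_option maxSynthPendingDepth 3

universe uE

variable {ι : Type*} [Fintype ι] [DecidableEq ι] {E : Type uE} [NormedAddCommGroup E] [NormedSpace ℂ E] [FiniteDimensional ℂ E]
  [Nontrivial E] (Φ : (ι → ℝ) ≃L[ℝ] E) {η : E [⋀^Fin 2]→L[ℝ] ℝ} (hη : ∀ v : E, v ≠ 0 → ∃ w : E, η ![v, w] ≠ 0) {N : ℕ}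

/-! ## §0 Toolkit -/

section Toolkit

omit [Fintype ι] [NormedAddCommGroup E] [NormedSpace ℂ E] [FiniteDimensional ℂ E] [Nontrivial E] in
/-- Re-reading the total degree does not change the orientation sign. [folklore] -/
private theorem orientationSign_finCongr_trans₅₁ {ι : Type*} [DecidableEq ι] {E : Type*} [NormedAddCommGroup E] [NormedSpace ℂ E]
    (Φ : (ι → ℝ) ≃L[ℝ] E) {m n : ℕ} (h : m = n) (e : Fin n ≃ ι) : orientationSign Φ ((finCongr h).trans e) = orientationSign Φ e := by
  subst h; rfl

omit [Fintype ι] [DecidableEq ι] [NormedAddCommGroup E] [NormedSpace ℂ E] [FiniteDimensional ℂ E] [Nontrivial E] in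
/-- `(−1)ᵐ = (−1)ᵏ` for `k + m` even. [folklore] -/
private theorem neg_one_pow_eq_of_add_eq_two_mul₅₁ {k m g : ℕ} (h : k + m = 2 * g) : (-1 : ℂ) ^ m = (-1) ^ k := by
  have h3 : (-1 : ℂ) ^ m * (-1) ^ k = (-1) ^ k * (-1) ^ k := by
    rw [← pow_add, ← pow_add, show m + k = 2 * g by omega, ← two_mul, pow_mul, pow_mul, neg_one_sq, one_pow, one_pow]
  exact mul_right_cancel₀ (pow_ne_zero k (neg_ne_zero.2 one_ne_zero)) h3

omit [Fintype ι] [DecidableEq ι] [NormedAddCommGroup E] [NormedSpace ℂ E] [FiniteDimensional ℂ E] [Nontrivial E] in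
/-- `(−1)^{2q(2q+1)/2} = (−1)^q` (`2q(2q+1)/2 = q(2q+1) ≡ q`). [folklore] -/
private theorem neg_one_pow_two_mul_mul_succ_div_two₅₁ (q : ℕ) : (-1 : ℂ) ^ (2 * q * (2 * q + 1) / 2) = (-1) ^ q := by
  have h : 2 * q * (2 * q + 1) / 2 = q * (2 * q + 1) := by rw [mul_assoc, Nat.mul_div_cancel_left _ two_pos]
  rw [h]
  rcases Nat.even_or_odd q with ⟨a, rfl⟩ | ⟨a, rfl⟩
  · have h1 : Even ((a + a) * (2 * (a + a) + 1)) := ⟨a * (2 * (a + a) + 1), by ring⟩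
    rw [h1.neg_one_pow, (show Even (a + a) from ⟨a, rfl⟩).neg_one_pow]
  · have h1 : Odd ((2 * a + 1) * (2 * (2 * a + 1) + 1)) := (odd_two_mul_add_one a).mul (odd_two_mul_add_one (2 * a + 1))
    rw [h1.neg_one_pow, (odd_two_mul_add_one a).neg_one_pow]

omit [Fintype ι] [DecidableEq ι] [NormedAddCommGroup E] [NormedSpace ℂ E] [FiniteDimensional ℂ E] [Nontrivial E] in
/-- The orientation sign squares to `1` in `ℂ`. [folklore] -/
private theorem orientationSign_mul_self_complex₅₁ {ι : Type*} [DecidableEq ι] {E : Type*} [NormedAddCommGroup E] [NormedSpace ℂ E]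
    (Φ : (ι → ℝ) ≃L[ℝ] E) {n : ℕ} (e : Fin n → ι) : (orientationSign Φ e : ℂ) * orientationSign Φ e = 1 := by
  exact_mod_cast orientationSign_mul_self Φ e

end Toolkit

/-! ## §1 Evaluation of `K_H`; it is André's `∫ x ∪ *_H y` up to `sign_X(e)` and Voisin's `Q_w` up to `sign_X(e)(−1)^g` -/

section Evaluation

omit [Fintype ι] [DecidableEq ι] in
/-- **`*_H : Hᵏ(X; ℂ) → H^{2g−k}(X; ℂ)` for EVERY normalisation `d`**: `*_H(of k x)` is homogeneous of degree `m`, `k + m = 2g` (p34's `andreHodgeInvolution_apply_mem`: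
`*_H` maps the `H`-weight space `M_{k−g}` to `M_{g−k}`; row g49-#3's `andreHodgeInvolution_of_eq_of` is the case `d = g`). [cite: Andre1996Motifs, §1.1 (p. 10, "`L^{d−j+k} x_{j−2k}`")] -/
theorem andreHodgeInvolution_of_eq_of' (hη : ∀ v : E, v ≠ 0 → ∃ w : E, η ![v, w] ≠ 0) (d : ℕ) {k m : ℕ} (h : k + m = 2 * finrank ℂ E)
    (x : E [⋀^Fin k]→L[ℝ] ℂ) :
    (hasLefschetzProperty_lefschetzG hη).andreHodgeInvolution isZGrading_countingG d (GForm.of k x) =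
      GForm.of m ((hasLefschetzProperty_lefschetzG hη).andreHodgeInvolution isZGrading_countingG d (GForm.of k x) m) := by
  have h1 := (hasLefschetzProperty_lefschetzG hη).andreHodgeInvolution_apply_mem isZGrading_countingG d (of_mem_degreeSpace_countingG (E := E) k x)
  rw [show -((k : ℤ) - (finrank ℂ E : ℤ)) = (m : ℤ) - (finrank ℂ E : ℤ) by omega] at h1
  exact (mem_degreeSpace_countingG_iff.1 h1).eq_of

/-- **`K_H(of k x, of k y) = ⟨x, (*_H y)_m⟩_e`** for `x, y ∈ Hᵏ(X; ℂ)`, `k + m = N = 2g` (`*_H y ∈ Hᵐ`), every normalisation `d`.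
[cite: Andre1996Motifs, Prop. 1.2 (p. 11, "la forme bilinéaire `(x, y) ↦ ∫ x ∪ * y` […] pour `* = *_L` ou `*_H`")] -/
theorem compl₂_andreHodgeInvolution_of_of (e : Fin N ≃ ι) (d : ℕ) {k m : ℕ} (h : k + m = N) (x y : E [⋀^Fin k]→L[ℝ] ℂ) :
    (poincarePairingG Φ e).compl₂ ((hasLefschetzProperty_lefschetzG hη).andreHodgeInvolution isZGrading_countingG d) (GForm.of k x) (GForm.of k y) =
      poincarePairing Φ e h x ((hasLefschetzProperty_lefschetzG hη).andreHodgeInvolution isZGrading_countingG d (GForm.of k y) m) := by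
  have hN := finrank_complex_mul_two Φ e
  rw [LinearMap.compl₂_apply, andreHodgeInvolution_of_eq_of' hη d (show k + m = 2 * finrank ℂ E by omega) y, poincarePairingG_of_of Φ e h,
    GForm.of_apply_self]

/-- **Different degrees are `K_H`-orthogonal: `K_H(of k x, of k' y) = 0` for `k ≠ k'`** (`*_H y ∈ H^{2g−k'}` pairs only with `H^{k'}`).
[cite: Andre1996Motifs, Prop. 1.2 (p. 11)] -/
theorem compl₂_andreHodgeInvolution_of_of_of_ne (e : Fin N ≃ ι) (d : ℕ) {k k' : ℕ} (hkk' : k ≠ k') (x : E [⋀^Fin k]→L[ℝ] ℂ)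
    (y : E [⋀^Fin k']→L[ℝ] ℂ) :
    (poincarePairingG Φ e).compl₂ ((hasLefschetzProperty_lefschetzG hη).andreHodgeInvolution isZGrading_countingG d) (GForm.of k x) (GForm.of k' y) = 0 := by
  have hN := finrank_complex_mul_two Φ e
  by_cases hk' : k' ≤ 2 * finrank ℂ E
  · rw [LinearMap.compl₂_apply, andreHodgeInvolution_of_eq_of' hη d (show k' + (2 * finrank ℂ E - k') = 2 * finrank ℂ E by omega) y,
      poincarePairingG_of_of_of_ne Φ e (show k + (2 * finrank ℂ E - k') ≠ N by omega)]
  · rw [eq_zero_of_finrank_real_lt y (by rw [finrank_real_of_complex]; omega), GForm.of_zero, LinearMap.compl₂_apply, map_zero, map_zero]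

omit [Fintype ι] in
/-- **`K_H(w, *_H w') = B(w, w')`** (`*_H² = 1`). [cite: Andre1996Motifs, §1.1 (p. 10) and Prop. 1.2 (p. 12, proof)] -/
theorem compl₂_andreHodgeInvolution_apply_andreHodgeInvolution (e : Fin N ≃ ι) (d : ℕ) (w w' : GForm E ℂ) :
    (poincarePairingG Φ e).compl₂ ((hasLefschetzProperty_lefschetzG hη).andreHodgeInvolution isZGrading_countingG d) w
      ((hasLefschetzProperty_lefschetzG hη).andreHodgeInvolution isZGrading_countingG d w') = poincarePairingG Φ e w w' := by
  rw [LinearMap.compl₂_apply, (hasLefschetzProperty_lefschetzG hη).andreHodgeInvolution_andreHodgeInvolution]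

/-- **`*_H` IS A `B`-ISOMETRY: `B(*_H w, *_H w') = B(w, w')`** (`*_H` is `B`-self-adjoint, row g51-#1, and an involution). [cite: Andre1996Motifs, §1.1 Remarque (p. 11)] -/
theorem isOrthogonal_poincarePairingG_andreHodgeInvolution (hη : ∀ v : E, v ≠ 0 → ∃ w : E, η ![v, w] ≠ 0) (e : Fin N ≃ ι) (d : ℕ) :
    (poincarePairingG Φ e).IsOrthogonal ((hasLefschetzProperty_lefschetzG hη).andreHodgeInvolution isZGrading_countingG d) := fun w w' ↦ by
  rw [isSelfAdjoint_poincarePairingG_andreHodgeInvolution Φ hη e d, (hasLefschetzProperty_lefschetzG hη).andreHodgeInvolution_andreHodgeInvolution]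

/-- **`K_H(*_H w, w') = B(w, w')`** (`*_H` is a `B`-isometry). [cite: Andre1996Motifs, §1.1 Remarque (p. 11)] -/
theorem compl₂_andreHodgeInvolution_andreHodgeInvolution_apply (e : Fin N ≃ ι) (d : ℕ) (w w' : GForm E ℂ) :
    (poincarePairingG Φ e).compl₂ ((hasLefschetzProperty_lefschetzG hη).andreHodgeInvolution isZGrading_countingG d)
      ((hasLefschetzProperty_lefschetzG hη).andreHodgeInvolution isZGrading_countingG d w) w' = poincarePairingG Φ e w w' := by
  rw [LinearMap.compl₂_apply]
  exact isOrthogonal_poincarePairingG_andreHodgeInvolution Φ hη e d w w'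

/-- **`*_H` IS `K_H`-SELF-ADJOINT: `K_H(*_H w, w') = K_H(w, *_H w')`** (both are `B(w, w')`). [cite: Andre1996Motifs, §1.1 Remarque (p. 11)] -/
theorem isSelfAdjoint_compl₂_andreHodgeInvolution_andreHodgeInvolution (e : Fin N ≃ ι) (d : ℕ) :
    ((poincarePairingG Φ e).compl₂ ((hasLefschetzProperty_lefschetzG hη).andreHodgeInvolution isZGrading_countingG d)).IsSelfAdjoint
      ((hasLefschetzProperty_lefschetzG hη).andreHodgeInvolution isZGrading_countingG d) := fun w w' ↦ by
  rw [compl₂_andreHodgeInvolution_andreHodgeInvolution_apply Φ hη e d, compl₂_andreHodgeInvolution_apply_andreHodgeInvolution Φ hη e d]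

/-- **`K_H` IS ANDRÉ'S PRINTED FORM `∫ x ∪ *_H y` UP TO THE ORIENTATION SIGN: `K_H(of k x, of k y) = sign_X(e) · ∫_X x ∧ (*_H y)_t`**, `k + t = 2g`, `e : Fin (2g) ≃ ι`
(`B_e = sign_X(e) ∫_X`, `ComplexTorusCycleClassPairing`). [cite: Andre1996Motifs, Prop. 1.2 (p. 11, "la forme bilinéaire `(x, y) ↦ ∫ x ∪ * y`")]
[cite: Lange2023AbelianVarietiesComplex, §1.7.2 Lemma 1.7.5 (the orientation)] -/
theorem compl₂_andreHodgeInvolution_of_of_eq_orientationSign_mul_torusIntegral {g : ℕ} (e : Fin (2 * g) ≃ ι) (d : ℕ) {k t : ℕ} (hkt : k + t = 2 * g)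
    (x y : E [⋀^Fin k]→L[ℝ] ℂ) :
    (poincarePairingG Φ e).compl₂ ((hasLefschetzProperty_lefschetzG hη).andreHodgeInvolution isZGrading_countingG d) (GForm.of k x) (GForm.of k y) =
      orientationSign Φ e * torusIntegral Φ e ((x.wedge ((hasLefschetzProperty_lefschetzG hη).andreHodgeInvolution isZGrading_countingG d (GForm.of k y) t)).domDomCongr
        (finCongr hkt)) := by
  rw [compl₂_andreHodgeInvolution_of_of Φ hη e d hkt, poincarePairing_eq_orientationSign_mul_torusIntegral_wedge, orientationSign_finCongr_trans₅₁,
    torusIntegral_finCongr_trans]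

/-- **`K_H(of k x, of k y) = sign_X(e) · (−1)^g · (−1)^{k(k−1)/2} B_k^w(x, y)`** (`B_k^w = weylPairing`, the Weyl pairing `∫_X w(x) ∧ y` of row g48-#2; normalisation `d = g`):
from `(−1)^{k(k−1)/2} B_k^w(x, y) = (−1)^g ∫_X x ∧ *_H y` (row g49-#3). [cite: Andre1996Motifs, §1.2 and Prop. 1.2 (p. 11)] [cite: VoisinHodgeI2002, §7.1.2 Def. 7.7 (PDF p. 134)] -/
theorem compl₂_andreHodgeInvolution_of_of_eq_orientationSign_mul_weylPairing {g : ℕ} (e : Fin (2 * g) ≃ ι) {k t : ℕ} (htk : t + k = 2 * g)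
    (x y : E [⋀^Fin k]→L[ℝ] ℂ) :
    (poincarePairingG Φ e).compl₂ ((hasLefschetzProperty_lefschetzG hη).andreHodgeInvolution isZGrading_countingG g) (GForm.of k x) (GForm.of k y) =
      orientationSign Φ e * (-1) ^ g * (-1) ^ (k * (k - 1) / 2) * weylPairing Φ hη e htk x y := by
  have h1 := neg_one_pow_mul_weylPairing_eq_torusIntegral_wedge_andreHodgeInvolution Φ hη e htk (show k + t = 2 * g by omega) x y
  have hsq : (-1 : ℂ) ^ g * (-1) ^ g = 1 := by rw [← pow_add, ← two_mul, pow_mul, neg_one_sq, one_pow]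
  have hT := congrArg (fun z ↦ (-1 : ℂ) ^ g * z) h1
  rw [← mul_assoc ((-1 : ℂ) ^ g) ((-1 : ℂ) ^ g), hsq, one_mul] at hT
  rw [compl₂_andreHodgeInvolution_of_of_eq_orientationSign_mul_torusIntegral Φ hη e g (show k + t = 2 * g by omega), ← hT]
  ring

/-- **VOISIN'S WEYL POLARIZATION FORM IS ANDRÉ'S `K_H`, UP TO `sign_X(e)(−1)^g`: `Q_w(γ, δ) = sign_X(e) · (−1)^g · K_H(of k γ, of k δ)`** on `Hᵏ(X; ℚ)` (`η ∈ NS(X) ⊗ ℚ`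
non-degenerate, `Q_w = weylPolarizationForm = (−1)^{k(k−1)/2} B_k^w`). [cite: Andre1996Motifs, §1.1 Remarque and Prop. 1.2 (p. 11)] [cite: VoisinHodgeI2002, §7.1.2 Def. 7.7 (PDF p. 134)] -/
theorem coe_weylPolarizationForm_eq_orientationSign_mul_compl₂_andreHodgeInvolution (hQ : η ∈ neronSeveriQ Φ) (hη : ∀ v : E, v ≠ 0 → ∃ w : E, η ![v, w] ≠ 0)
    {g : ℕ} (e : Fin (2 * g) ≃ ι) {k t : ℕ} (htk : t + k = 2 * g) (γ δ : rationalForms Φ k) :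
    ((weylPolarizationForm Φ hQ hη e htk γ δ : ℚ) : ℂ) =
      orientationSign Φ e * (-1) ^ g * (poincarePairingG Φ e).compl₂ ((hasLefschetzProperty_lefschetzG hη).andreHodgeInvolution isZGrading_countingG g)
        (GForm.of k (γ : E [⋀^Fin k]→L[ℝ] ℂ)) (GForm.of k (δ : E [⋀^Fin k]→L[ℝ] ℂ)) := by
  rw [coe_weylPolarizationForm, compl₂_andreHodgeInvolution_of_of_eq_orientationSign_mul_weylPairing Φ hη e htk]
  have hs := orientationSign_mul_self_complex₅₁ Φ e
  have hsq : (-1 : ℂ) ^ g * (-1) ^ g = 1 := by rw [← pow_add, ← two_mul, pow_mul, neg_one_sq, one_pow]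
  linear_combination (-((-1 : ℂ) ^ (k * (k - 1) / 2) * weylPairing Φ hη e htk γ δ) * (-1) ^ g * (-1) ^ g) * hs
    + (-((-1 : ℂ) ^ (k * (k - 1) / 2) * weylPairing Φ hη e htk γ δ)) * hsq

/-- **On a polarized torus the `Polarization` of row g48-#3 is André's `K_H` up to `sign_X(e)(−1)^g`: `Q(γ, δ) = sign_X(e)(−1)^g K_H(of s γ, of s δ)`.**
[cite: Andre1996Motifs, §1.1 Remarque and Prop. 1.2 (p. 11)] [cite: VoisinHodgeI2002, §7.1.2 Def. 7.7 (PDF p. 134)] -/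
theorem IsRiemannForm.coe_weylPolarization_form_eq_orientationSign_mul_compl₂_andreHodgeInvolution (hR : IsRiemannForm Φ η) {g : ℕ} (e : Fin (2 * g) ≃ ι)
    {s t : ℕ} (hts : t + s = 2 * g) (γ δ : rationalForms Φ s) :
    (((hR.weylPolarization Φ e hts).form γ δ : ℚ) : ℂ) =
      orientationSign Φ e * (-1) ^ g * (poincarePairingG Φ e).compl₂ ((hasLefschetzProperty_lefschetzG (hR.exists_apply_ne_zero Φ)).andreHodgeInvolution
        isZGrading_countingG g) (GForm.of s (γ : E [⋀^Fin s]→L[ℝ] ℂ)) (GForm.of s (δ : E [⋀^Fin s]→L[ℝ] ℂ)) := by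
  rw [hR.weylPolarization_form Φ e hts, coe_weylPolarizationForm_eq_orientationSign_mul_compl₂_andreHodgeInvolution Φ _ _ e hts]

end Evaluation

/-! ## §2 André's Prop. 1.2, last clause, for `* = *_H`: the `K_H`-transposition exchanges `L_η` and `Λ_η` -/

section Transposition

omit [Fintype ι] in
/-- **THE `K_H`-TRANSPOSE OF `T` IS `*_H Tᵗ *_H`**, `Tᵗ` a `B`-transpose of `T`: `K_H(T w, w') = K_H(w, (*_H Tᵗ *_H) w')` (`*_H² = 1`).
[cite: Andre1996Motifs, Prop. 1.2 (pp. 11–12, proof: "il suffit de la tester sur les générateurs")] -/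
theorem isAdjointPair_compl₂_andreHodgeInvolution_of_isAdjointPair (e : Fin N ≃ ι) (d : ℕ) {T T' : Module.End ℂ (GForm E ℂ)}
    (hTT' : LinearMap.IsAdjointPair (poincarePairingG Φ e) (poincarePairingG Φ e) T T') :
    LinearMap.IsAdjointPair ((poincarePairingG Φ e).compl₂ ((hasLefschetzProperty_lefschetzG hη).andreHodgeInvolution isZGrading_countingG d))
      ((poincarePairingG Φ e).compl₂ ((hasLefschetzProperty_lefschetzG hη).andreHodgeInvolution isZGrading_countingG d)) ⇑T
      ⇑((hasLefschetzProperty_lefschetzG hη).andreHodgeInvolution isZGrading_countingG d * T' *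
        (hasLefschetzProperty_lefschetzG hη).andreHodgeInvolution isZGrading_countingG d) := fun w w' ↦ by
  rw [LinearMap.compl₂_apply, LinearMap.compl₂_apply, hTT', Module.End.mul_apply, Module.End.mul_apply,
    (hasLefschetzProperty_lefschetzG hη).andreHodgeInvolution_andreHodgeInvolution]

omit [Fintype ι] in
/-- **"CES GÉNÉRATEURS S'ÉCHANGENT PAR LA TRANSPOSITION", ON THE NOSE FOR `*_H`: `K_H(L_η w, w') = K_H(w, Λ_η w')`** — `L_η` and `Λ_η` are mutually `K_H`-adjoint
(`L_η` is `B`-self-adjoint, `*_H L_η *_H = Λ_η` exactly — p34's `isAdjointPair_compl₂_andreHodgeInvolution` with the torus dictionary `dual = Λ_η`; for `*_L` one only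
gets André's `ᶜL`, proportional to `Λ_η` on each piece). [cite: Andre1996Motifs, Prop. 1.2 (pp. 11–12, "pour `* = *_L` ou `*_H`")] -/
theorem isAdjointPair_compl₂_andreHodgeInvolution_lefschetzG_lefschetzDualG (e : Fin N ≃ ι) (d : ℕ) :
    LinearMap.IsAdjointPair ((poincarePairingG Φ e).compl₂ ((hasLefschetzProperty_lefschetzG hη).andreHodgeInvolution isZGrading_countingG d))
      ((poincarePairingG Φ e).compl₂ ((hasLefschetzProperty_lefschetzG hη).andreHodgeInvolution isZGrading_countingG d)) ⇑(lefschetzG η) ⇑(lefschetzDualG η) := by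
  rw [← dual_lefschetzG_eq_lefschetzDualG hη]
  exact (hasLefschetzProperty_lefschetzG hη).isAdjointPair_compl₂_andreHodgeInvolution isZGrading_countingG d (isSelfAdjoint_poincarePairingG_lefschetzG Φ η e)

/-- **… and `K_H(Λ_η w, w') = K_H(w, L_η w')`** (p34's `isAdjointPair_compl₂_andreHodgeInvolution'`). [cite: Andre1996Motifs, Prop. 1.2 (pp. 11–12)] -/
theorem isAdjointPair_compl₂_andreHodgeInvolution_lefschetzDualG_lefschetzG (e : Fin N ≃ ι) (d : ℕ) :
    LinearMap.IsAdjointPair ((poincarePairingG Φ e).compl₂ ((hasLefschetzProperty_lefschetzG hη).andreHodgeInvolution isZGrading_countingG d))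
      ((poincarePairingG Φ e).compl₂ ((hasLefschetzProperty_lefschetzG hη).andreHodgeInvolution isZGrading_countingG d)) ⇑(lefschetzDualG η) ⇑(lefschetzG η) := by
  rw [← dual_lefschetzG_eq_lefschetzDualG hη]
  exact (hasLefschetzProperty_lefschetzG hη).isAdjointPair_compl₂_andreHodgeInvolution' isZGrading_countingG d (isSkewAdjoint_poincarePairingG_countingG Φ e)
    (isSelfAdjoint_poincarePairingG_lefschetzG Φ η e)

/-- **The counting operator `H` is `K_H`-SYMMETRIC: `K_H(H w, w') = K_H(w, H w')`** (`Hᵀ = −H` for `B` and `*_H H = −H *_H`). [cite: Andre1996Motifs, §1.2 (p. 11)] -/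
theorem isSelfAdjoint_compl₂_andreHodgeInvolution_countingG (e : Fin N ≃ ι) (d : ℕ) :
    ((poincarePairingG Φ e).compl₂ ((hasLefschetzProperty_lefschetzG hη).andreHodgeInvolution isZGrading_countingG d)).IsSelfAdjoint (countingG E) :=
  (hasLefschetzProperty_lefschetzG hη).isSelfAdjoint_compl₂_andreHodgeInvolution_h isZGrading_countingG (isSkewAdjoint_poincarePairingG_countingG Φ e)
    (isSelfAdjoint_poincarePairingG_lefschetzG Φ η e) d

/-- **`ρ(γ)` AND `ρ(γᵀ)` ARE MUTUALLY `K_H`-ADJOINT for every `γ ∈ SL₂(ℂ)`**: `K_H(ρ(γ) w, w') = K_H(w, ρ(γᵀ) w')` — for André's form the transpose of the Lefschetz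
`SL₂`-action is the transposed matrix (p34's `isAdjointPair_compl₂_andreHodgeInvolution_sl2Rep_transpose`). [cite: Andre1996Motifs, Prop. 1.2 (pp. 11–12)] [cite: Beauville2010SL2, §3 Theorem] -/
theorem isAdjointPair_compl₂_andreHodgeInvolution_sl2Rep_transpose (e : Fin N ≃ ι) (d : ℕ) (γ : SL(2, ℂ)) :
    LinearMap.IsAdjointPair ((poincarePairingG Φ e).compl₂ ((hasLefschetzProperty_lefschetzG hη).andreHodgeInvolution isZGrading_countingG d))
      ((poincarePairingG Φ e).compl₂ ((hasLefschetzProperty_lefschetzG hη).andreHodgeInvolution isZGrading_countingG d))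
      ((hasLefschetzProperty_lefschetzG hη).sl2Rep isZGrading_countingG γ) ((hasLefschetzProperty_lefschetzG hη).sl2Rep isZGrading_countingG γ.transpose) :=
  (hasLefschetzProperty_lefschetzG hη).isAdjointPair_compl₂_andreHodgeInvolution_sl2Rep_transpose isZGrading_countingG (isSkewAdjoint_poincarePairingG_countingG Φ e)
    (isSelfAdjoint_poincarePairingG_lefschetzG Φ η e) d γ

/-- **The Weyl operator `w` is a `K_H`-ISOMETRY: `K_H(w x, w y) = K_H(x, y)`.** [cite: Andre1996Motifs, §1.2 and Prop. 1.2 (p. 11)] -/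
theorem isOrthogonal_compl₂_andreHodgeInvolution_weylOperator (e : Fin N ≃ ι) (d : ℕ) :
    ((poincarePairingG Φ e).compl₂ ((hasLefschetzProperty_lefschetzG hη).andreHodgeInvolution isZGrading_countingG d)).IsOrthogonal
      ((hasLefschetzProperty_lefschetzG hη).weylOperator isZGrading_countingG) :=
  (hasLefschetzProperty_lefschetzG hη).isOrthogonal_compl₂_andreHodgeInvolution_weylOperator isZGrading_countingG (isSkewAdjoint_poincarePairingG_countingG Φ e)
    (isSelfAdjoint_poincarePairingG_lefschetzG Φ η e) d

/-- **`γᵀγ = 1 ⇒ ρ(γ)` is a `K_H`-isometry** (`SO₂(ℂ) ⊂ SL₂(ℂ)` acts by isometries of André's form). [cite: Andre1996Motifs, Prop. 1.2 (pp. 11–12)] [cite: LooijengaLunts1997, §1 (1.3) p. 5] -/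
theorem isOrthogonal_compl₂_andreHodgeInvolution_sl2Rep_of_transpose_mul_self (e : Fin N ≃ ι) (d : ℕ) {γ : SL(2, ℂ)} (hγ : γ.transpose * γ = 1) :
    ((poincarePairingG Φ e).compl₂ ((hasLefschetzProperty_lefschetzG hη).andreHodgeInvolution isZGrading_countingG d)).IsOrthogonal
      ((hasLefschetzProperty_lefschetzG hη).sl2Rep isZGrading_countingG γ) :=
  (hasLefschetzProperty_lefschetzG hη).isOrthogonal_compl₂_andreHodgeInvolution_sl2Rep_of_transpose_mul_self isZGrading_countingG
    (isSkewAdjoint_poincarePairingG_countingG Φ e) (isSelfAdjoint_poincarePairingG_lefschetzG Φ η e) d hγ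

/-- **THE DEGREE-`0` PART OF `ℂ[L_η, Λ_η]` IS `K_H`-SYMMETRIC**: every `T ∈ ℂ[L_η, Λ_η]` commuting with `H` (the Lefschetz–Künneth projectors `pʲ`, "contiennent les
projecteurs de Künneth") satisfies `K_H(T w, w') = K_H(w, T w')`. [cite: Andre1996Motifs, Prop. 1.2 (pp. 11–12)] [cite: Kleiman1968AlgebraicCycles, §1.4, 1.4.4] -/
theorem isSelfAdjoint_compl₂_andreHodgeInvolution_of_mem_adjoin_pair_of_commute (e : Fin N ≃ ι) (d : ℕ) {T : Module.End ℂ (GForm E ℂ)}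
    (hT : T ∈ Algebra.adjoin ℂ ({lefschetzG η, lefschetzDualG η} : Set (Module.End ℂ (GForm E ℂ)))) (hTh : Commute (countingG E) T) :
    ((poincarePairingG Φ e).compl₂ ((hasLefschetzProperty_lefschetzG hη).andreHodgeInvolution isZGrading_countingG d)).IsSelfAdjoint T := by
  rw [← dual_lefschetzG_eq_lefschetzDualG hη] at hT
  exact (hasLefschetzProperty_lefschetzG hη).isSelfAdjoint_compl₂_andreHodgeInvolution_of_mem_adjoin_pair_dual_of_commute isZGrading_countingG
    (isSkewAdjoint_poincarePairingG_countingG Φ e) (isSelfAdjoint_poincarePairingG_lefschetzG Φ η e) d hT hTh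

/-- **`ℂ[L_η, Λ_η]` IS STABLE UNDER `K_H`-TRANSPOSITION**: every `T ∈ ℂ[L_η, Λ_η]` has a `K_H`-adjoint inside `ℂ[L_η, Λ_η]` (`*_H Tᵗ *_H`, with `Tᵗ ∈ ℂ[L_η, Λ_η]` a
`B`-adjoint — row g51-#1 — and `*_H ∈ ℂ[L_η, Λ_η]`, p34's `andreHodgeInvolution_mem_adjoin_pair_dual`). [cite: Andre1996Motifs, Prop. 1.2 (pp. 11–12)] -/
theorem exists_mem_adjoin_isAdjointPair_compl₂_andreHodgeInvolution (e : Fin N ≃ ι) (d : ℕ) {T : Module.End ℂ (GForm E ℂ)}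
    (hT : T ∈ Algebra.adjoin ℂ ({lefschetzG η, lefschetzDualG η} : Set (Module.End ℂ (GForm E ℂ)))) :
    ∃ T' ∈ Algebra.adjoin ℂ ({lefschetzG η, lefschetzDualG η} : Set (Module.End ℂ (GForm E ℂ))),
      LinearMap.IsAdjointPair ((poincarePairingG Φ e).compl₂ ((hasLefschetzProperty_lefschetzG hη).andreHodgeInvolution isZGrading_countingG d))
        ((poincarePairingG Φ e).compl₂ ((hasLefschetzProperty_lefschetzG hη).andreHodgeInvolution isZGrading_countingG d)) T T' := by
  obtain ⟨T', hT', hTT'⟩ := exists_mem_adjoin_isAdjointPair_poincarePairingG Φ hη e hT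
  have hs : (hasLefschetzProperty_lefschetzG hη).andreHodgeInvolution isZGrading_countingG d ∈
      Algebra.adjoin ℂ ({lefschetzG η, lefschetzDualG η} : Set (Module.End ℂ (GForm E ℂ))) := by
    rw [← dual_lefschetzG_eq_lefschetzDualG hη]
    exact (hasLefschetzProperty_lefschetzG hη).andreHodgeInvolution_mem_adjoin_pair_dual isZGrading_countingG d
  exact ⟨_, Subalgebra.mul_mem _ (Subalgebra.mul_mem _ hs hT') hs, isAdjointPair_compl₂_andreHodgeInvolution_of_isAdjointPair Φ hη e d hTT'⟩

end Transposition

/-! ## §3 `(−1)ᵏ`-symmetry, non-degeneracy, `ℚ`-values -/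

section Symmetry

/-- **`K_H` IS `(−1)ᵏ`-SYMMETRIC: `K_H(w, of k x) = (−1)ᵏ K_H(of k x, w)`** for a homogeneous class `x` of degree `k` and every `w` (`*_H x ∈ H^{2g−k}`, graded symmetry of
`B`, `*_H` self-adjoint, `(−1)^{2g−k} = (−1)ᵏ`). [cite: Andre1996Motifs, §1.1 Remarque (p. 11) and Prop. 1.2 (p. 11)] [cite: Kleiman1968AlgebraicCycles, §1.4 and §3] -/
theorem compl₂_andreHodgeInvolution_apply_of_comm (e : Fin N ≃ ι) (d : ℕ) {k : ℕ} (x : E [⋀^Fin k]→L[ℝ] ℂ) (w : GForm E ℂ) :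
    (poincarePairingG Φ e).compl₂ ((hasLefschetzProperty_lefschetzG hη).andreHodgeInvolution isZGrading_countingG d) w (GForm.of k x) =
      (-1) ^ k * (poincarePairingG Φ e).compl₂ ((hasLefschetzProperty_lefschetzG hη).andreHodgeInvolution isZGrading_countingG d) (GForm.of k x) w := by
  have hN := finrank_complex_mul_two Φ e
  by_cases hk : k ≤ 2 * finrank ℂ E
  · have hkm : k + (2 * finrank ℂ E - k) = 2 * finrank ℂ E := by omega
    rw [LinearMap.compl₂_apply, LinearMap.compl₂_apply, andreHodgeInvolution_of_eq_of' hη d hkm x, poincarePairingG_apply_of_comm,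
      ← andreHodgeInvolution_of_eq_of' hη d hkm x, isSelfAdjoint_poincarePairingG_andreHodgeInvolution Φ hη e d (GForm.of k x) w,
      neg_one_pow_eq_of_add_eq_two_mul₅₁ hkm]
  · rw [eq_zero_of_finrank_real_lt x (by rw [finrank_real_of_complex]; omega), GForm.of_zero, map_zero, map_zero, LinearMap.zero_apply, mul_zero]

/-- Homogeneous form: `K_H(of k' y, of k x) = (−1)ᵏ K_H(of k x, of k' y)`. [cite: Andre1996Motifs, Prop. 1.2 (p. 11)] [cite: Kleiman1968AlgebraicCycles, §1.4] -/
theorem compl₂_andreHodgeInvolution_of_of_comm (e : Fin N ≃ ι) (d : ℕ) {k k' : ℕ} (x : E [⋀^Fin k]→L[ℝ] ℂ) (y : E [⋀^Fin k']→L[ℝ] ℂ) :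
    (poincarePairingG Φ e).compl₂ ((hasLefschetzProperty_lefschetzG hη).andreHodgeInvolution isZGrading_countingG d) (GForm.of k' y) (GForm.of k x) =
      (-1) ^ k * (poincarePairingG Φ e).compl₂ ((hasLefschetzProperty_lefschetzG hη).andreHodgeInvolution isZGrading_countingG d) (GForm.of k x)
        (GForm.of k' y) :=
  compl₂_andreHodgeInvolution_apply_of_comm Φ hη e d x (GForm.of k' y)

omit [Fintype ι] in
/-- **`K_H` IS NON-DEGENERATE on `H•(X; ℂ)`** (`B` is, and `*_H` is invertible). [cite: Andre1996Motifs, Prop. 1.2 (p. 11)] [cite: Lange2023AbelianVarietiesComplex, §6.2.4 (p. 310)] -/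
theorem compl₂_andreHodgeInvolution_nondegenerate [Fintype ι] (e : Fin N ≃ ι) (d : ℕ) :
    ((poincarePairingG Φ e).compl₂ ((hasLefschetzProperty_lefschetzG hη).andreHodgeInvolution isZGrading_countingG d)).Nondegenerate := by
  obtain ⟨hl, hr⟩ := poincarePairingG_nondegenerate Φ e
  refine ⟨fun w hw ↦ hl w fun w' ↦ ?_, fun w' hw ↦ ?_⟩
  · have h1 := hw ((hasLefschetzProperty_lefschetzG hη).andreHodgeInvolution isZGrading_countingG d w')
    rwa [compl₂_andreHodgeInvolution_apply_andreHodgeInvolution Φ hη e d] at h1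
  · have h1 : (hasLefschetzProperty_lefschetzG hη).andreHodgeInvolution isZGrading_countingG d w' = 0 := hr _ fun w ↦ by
      have h2 := hw w
      rwa [LinearMap.compl₂_apply] at h2
    rw [← (hasLefschetzProperty_lefschetzG hη).andreHodgeInvolution_andreHodgeInvolution isZGrading_countingG d w', h1, map_zero]

/-- **`K_H` IS NON-DEGENERATE ON EACH `Hᵏ(X; ℂ)`**: `K_H(of k x, of k y) = 0` for all `y ∈ Hᵏ` forces `x = 0` (`*_H : Hᵏ ⥲ H^{2g−k}` and Poincaré duality).
[cite: Andre1996Motifs, Prop. 1.2 (p. 11)] [cite: Lange2023AbelianVarietiesComplex, §6.2.4 (p. 310)] -/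
theorem eq_zero_of_forall_compl₂_andreHodgeInvolution_of_of_eq_zero (e : Fin N ≃ ι) (d : ℕ) {k : ℕ} {x : E [⋀^Fin k]→L[ℝ] ℂ}
    (hx : ∀ y : E [⋀^Fin k]→L[ℝ] ℂ, (poincarePairingG Φ e).compl₂ ((hasLefschetzProperty_lefschetzG hη).andreHodgeInvolution isZGrading_countingG d)
      (GForm.of k x) (GForm.of k y) = 0) : x = 0 := by
  have hN := finrank_complex_mul_two Φ e
  by_cases hk : k ≤ 2 * finrank ℂ E
  · have hmk : (2 * finrank ℂ E - k) + k = 2 * finrank ℂ E := by omega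
    refine eq_zero_of_forall_right_poincarePairing_eq_zero Φ e (show k + (2 * finrank ℂ E - k) = N by omega) fun z ↦ ?_
    set L := hasLefschetzProperty_lefschetzG hη with hL
    have h1 := hx (L.andreHodgeInvolution isZGrading_countingG d (GForm.of (2 * finrank ℂ E - k) z) k)
    rwa [compl₂_andreHodgeInvolution_of_of Φ hη e d (show k + (2 * finrank ℂ E - k) = N by omega), ← andreHodgeInvolution_of_eq_of' hη d hmk z,
      L.andreHodgeInvolution_andreHodgeInvolution isZGrading_countingG d, GForm.of_apply_self] at h1
  · exact eq_zero_of_finrank_real_lt x (by rw [finrank_real_of_complex]; omega)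

/-- **`K_H(H•(X; ℚ), H•(X; ℚ)) ⊆ ℚ` for every non-degenerate `η ∈ NS(X) ⊗ ℚ`** (`*_H` normalised by `d = g` is defined over `ℚ`, row g49-#3, and `B` is `ℚ`-valued on rational
classes): André's form is DEFINED OVER `ℚ`. [cite: Andre1996Motifs, Prop. 1.2 (p. 11, "`ℚ[L, *_L]` […] de `End H*(X)`")] [cite: LooijengaLunts1997, §1 (1.7) p. 6] -/
theorem compl₂_andreHodgeInvolution_mem_range_rat (hQ : η ∈ neronSeveriQ Φ) (hη : ∀ v : E, v ≠ 0 → ∃ w : E, η ![v, w] ≠ 0) (e : Fin N ≃ ι)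
    {w w' : GForm E ℂ} (hw : w ∈ rationalFormsG Φ) (hw' : w' ∈ rationalFormsG Φ) :
    ∃ q : ℚ, (poincarePairingG Φ e).compl₂ ((hasLefschetzProperty_lefschetzG hη).andreHodgeInvolution isZGrading_countingG (finrank ℂ E)) w w' = q := by
  rw [LinearMap.compl₂_apply]
  exact poincarePairingG_mem_range_rat Φ e hw (andreHodgeInvolution_apply_mem_rationalFormsG Φ hQ hη rfl hw')

/-- **`K_H(Hdgᵖ(X), Hdgᵖ(X)) ⊆ ℚ`.** [cite: Andre1996Motifs, §1.1 Remarque and Prop. 1.2 (p. 11)] [cite: Lange2023AbelianVarietiesComplex, §7.2.2] -/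
theorem compl₂_andreHodgeInvolution_of_of_mem_range_rat_of_mem_hodgeClasses (hQ : η ∈ neronSeveriQ Φ) (hη : ∀ v : E, v ≠ 0 → ∃ w : E, η ![v, w] ≠ 0)
    (e : Fin N ≃ ι) {p : ℕ} {x y : E [⋀^Fin (2 * p)]→L[ℝ] ℂ} (hx : x ∈ hodgeClasses Φ p) (hy : y ∈ hodgeClasses Φ p) :
    ∃ q : ℚ, (poincarePairingG Φ e).compl₂ ((hasLefschetzProperty_lefschetzG hη).andreHodgeInvolution isZGrading_countingG (finrank ℂ E)) (GForm.of (2 * p) x)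
      (GForm.of (2 * p) y) = q :=
  compl₂_andreHodgeInvolution_mem_range_rat Φ hQ hη e (of_mem_rationalFormsG Φ hx.1) (of_mem_rationalFormsG Φ hy.1)

end Symmetry

/-! ## §4 `K_H` against the Lefschetz decomposition: orthogonal, and `K_H = (j!/(n−j)!) K_∗ = (−1)^{m(m+1)/2}(j!/(n−j)!) K_L` on `Lʲ Pᵐ` -/

section Lefschetz

/-- **STRINGS OF DIFFERENT LENGTH OR DIFFERENT POSITION ARE `K_H`-ORTHOGONAL: `K_H(of a (Lʲχ), of a' (L^{j'}χ')) = 0` unless `m = m' ∧ j = j'`** (`χ ∈ Pᵐ`, `χ' ∈ P^{m'}`,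
`m + n = g = m' + n'`, any `j, j'`, any normalisation `d`; p34's `apply_pow_primitive_andreHodgeInvolution_pow_primitive_eq_zero`: André's form is block-DIAGONAL on the
Lefschetz decomposition). [cite: Andre1996Motifs, Prop. 1.2 (pp. 11–12, proof)] [cite: Kleiman1968AlgebraicCycles, §1.4] -/
theorem compl₂_andreHodgeInvolution_of_lefschetzPow_of_lefschetzPow_eq_zero (e : Fin N ≃ ι) (d : ℕ) {g : ℕ} (hg : finrank ℂ E = g) {m n m' n' : ℕ}
    (hmn : m + n = g) (hmn' : m' + n' = g) {χ : E [⋀^Fin m]→L[ℝ] ℂ} (hχ : χ ∈ primitiveForms η m) {χ' : E [⋀^Fin m']→L[ℝ] ℂ}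
    (hχ' : χ' ∈ primitiveForms η m') {j j' a a' : ℕ} (ha : 2 * j + m = a) (ha' : 2 * j' + m' = a') (hne : ¬(m = m' ∧ j = j')) :
    (poincarePairingG Φ e).compl₂ ((hasLefschetzProperty_lefschetzG hη).andreHodgeInvolution isZGrading_countingG d) (GForm.of a (lefschetzPow η j ha χ))
      (GForm.of a' (lefschetzPow η j' ha' χ')) = 0 := by
  set L := hasLefschetzProperty_lefschetzG hη with hL
  have hp := of_mem_primitiveSpace_of_mem_primitiveForms hη (n := n) (by omega) hχ
  have hp' := of_mem_primitiveSpace_of_mem_primitiveForms hη (n := n') (by omega) hχ'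
  rw [LinearMap.compl₂_apply, ← lefschetzG_pow_of η j ha χ, ← lefschetzG_pow_of η j' ha' χ']
  exact L.apply_pow_primitive_andreHodgeInvolution_pow_primitive_eq_zero isZGrading_countingG (isSkewAdjoint_poincarePairingG_countingG Φ e)
    (isSelfAdjoint_poincarePairingG_lefschetzG Φ η e) d hp hp' fun h ↦ hne ⟨by omega, h.2⟩

/-- **THE LEFSCHETZ DECOMPOSITION `Hᵃ(X; ℂ) = ⊕_j Lʲ P^{a−2j}` IS `K_H`-ORTHOGONAL: `K_H(of a x, of a y) = 0` for `x ∈ Lʲ P^{a−2j}`, `y ∈ L^{j'} P^{a−2j'}`, `j ≠ j'`**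
in Milne's range `a ≤ g + j`, `a ≤ g + j'`. [cite: Andre1996Motifs, Prop. 1.2 (pp. 11–12)] [cite: Kleiman1968AlgebraicCycles, §1.4] [cite: Milne1999LefschetzClasses, §5 p. 664] -/
theorem compl₂_andreHodgeInvolution_of_of_eq_zero_of_mem_lefschetzSummandForms (e : Fin N ≃ ι) (d : ℕ) {a j j' : ℕ} (haj : a ≤ finrank ℂ E + j)
    (haj' : a ≤ finrank ℂ E + j') (hne : j ≠ j') {x y : E [⋀^Fin a]→L[ℝ] ℂ} (hx : x ∈ lefschetzSummandForms η a j)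
    (hy : y ∈ lefschetzSummandForms η a j') :
    (poincarePairingG Φ e).compl₂ ((hasLefschetzProperty_lefschetzG hη).andreHodgeInvolution isZGrading_countingG d) (GForm.of a x) (GForm.of a y) = 0 := by
  by_cases h2j : 2 * j ≤ a
  swap
  · rw [eq_zero_of_mem_lefschetzSummandForms η (by omega) hx, GForm.of_zero, map_zero, LinearMap.zero_apply]
  by_cases h2j' : 2 * j' ≤ a
  swap
  · rw [eq_zero_of_mem_lefschetzSummandForms η (by omega) hy, GForm.of_zero, map_zero]
  rw [lefschetzSummandForms_eq η (show 2 * j + (a - 2 * j) = a by omega)] at hx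
  rw [lefschetzSummandForms_eq η (show 2 * j' + (a - 2 * j') = a by omega)] at hy
  obtain ⟨χ, hχ, rfl⟩ := hx
  obtain ⟨χ', hχ', rfl⟩ := hy
  exact compl₂_andreHodgeInvolution_of_lefschetzPow_of_lefschetzPow_eq_zero Φ hη e d rfl (n := finrank ℂ E + 2 * j - a)
    (n' := finrank ℂ E + 2 * j' - a) (by omega) (by omega) hχ hχ' _ _ fun h ↦ hne h.2

omit [Fintype ι] in
/-- **ON A LEFSCHETZ SUMMAND: `K_H(of a (Lʲχ), of a (Lʲχ')) = (−1)^{m(m+1)/2} (j!/(n−j)!) ⟨Lⁿχ, χ'⟩_e`** for `χ' ∈ Pᵐ`, `m + n = g`, `j ≤ n` (`a = m + 2j`, `b = m + 2n`;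
`χ` any `m`-form; normalisation `d = g`): `*_H(Lʲχ') = (−1)^{m(m+1)/2}(j!/(n−j)!) L^{n−j}χ'` and `B(Lʲχ, L^{n−j}χ') = ⟨Lⁿχ, χ'⟩_e`.
[cite: Andre1996Motifs, §1.1 (p. 10, the formula for `*_H`) and Prop. 1.2 (pp. 11–12)] [cite: Kleiman1968AlgebraicCycles, §1.4 and §3] -/
theorem compl₂_andreHodgeInvolution_of_lefschetzPow_of_lefschetzPow (e : Fin N ≃ ι) {g : ℕ} (hg : finrank ℂ E = g) {m n : ℕ} (hmn : m + n = g)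
    (χ : E [⋀^Fin m]→L[ℝ] ℂ) {χ' : E [⋀^Fin m]→L[ℝ] ℂ} (hχ' : χ' ∈ primitiveForms η m) {j a b : ℕ} (hj : j ≤ n) (ha : 2 * j + m = a)
    (hb : 2 * n + m = b) (h : b + m = N) :
    (poincarePairingG Φ e).compl₂ ((hasLefschetzProperty_lefschetzG hη).andreHodgeInvolution isZGrading_countingG g) (GForm.of a (lefschetzPow η j ha χ))
      (GForm.of a (lefschetzPow η j ha χ')) =
      ((-1 : ℂ) ^ (m * (m + 1) / 2) * ((j ! : ℕ) : ℂ) * (((n - j) ! : ℕ) : ℂ)⁻¹) * poincarePairing Φ e h (lefschetzPow η n hb χ) χ' := by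
  set L := hasLefschetzProperty_lefschetzG hη with hL
  have hp' := of_mem_primitiveSpace_of_mem_primitiveForms hη (n := n) (by omega) hχ'
  rw [LinearMap.compl₂_apply, ← lefschetzG_pow_of η j ha χ, ← lefschetzG_pow_of η j ha χ', L.andreHodgeInvolution_apply_pow_primitive isZGrading_countingG g hp' hj,
    map_smul, smul_eq_mul, show g - n = m by omega,
    apply_pow_primitive_pow_primitive_eq (isSelfAdjoint_poincarePairingG_lefschetzG Φ η e) (show j + (n - j) = n by omega),
    lefschetzG_pow_of η n hb χ, poincarePairingG_of_of Φ e h]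

omit [Fintype ι] in
/-- **`K_H = (j!/(n−j)!) · K_∗` ON THE SUMMAND `Lʲ Pᵐ`, IN THE SECOND VARIABLE: `K_H(w, of a y) = (j!/(n−j)!) K_∗(w, of a y)`** for `y ∈ Lʲ Pᵐ` (`m + n = g`, `a = m + 2j`),
every `w ∈ H•(X; ℂ)` and every common normalisation `d` (`*_H = (j!/(n−j)!) ∗` there, p34's `andreHodgeInvolution_apply_pow_primitive_eq_smul_hodgeInvolution`; for `j > n`
the summand is `0`). [cite: Andre1996Motifs, §1.1 (p. 10)] [cite: Kleiman1968AlgebraicCycles, §1.4, 1.4.2] [cite: Milne1999LefschetzClasses, §5 p. 664] -/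
theorem compl₂_andreHodgeInvolution_apply_of_eq_mul_compl₂_hodgeInvolution_apply_of (e : Fin N ≃ ι) (d : ℕ) {g : ℕ} (hg : finrank ℂ E = g)
    {a j m n : ℕ} (hmn : m + n = g) (ha : 2 * j + m = a) {y : E [⋀^Fin a]→L[ℝ] ℂ} (hy : y ∈ lefschetzSummandForms η a j) (w : GForm E ℂ) :
    (poincarePairingG Φ e).compl₂ ((hasLefschetzProperty_lefschetzG hη).andreHodgeInvolution isZGrading_countingG d) w (GForm.of a y) =
      (((j ! : ℕ) : ℂ) * (((n - j) ! : ℕ) : ℂ)⁻¹) *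
        (poincarePairingG Φ e).compl₂ ((hasLefschetzProperty_lefschetzG hη).hodgeInvolution isZGrading_countingG d) w (GForm.of a y) := by
  set L := hasLefschetzProperty_lefschetzG hη with hL
  rw [lefschetzSummandForms_eq η ha] at hy
  obtain ⟨χ, hχ, rfl⟩ := hy
  by_cases hj : j ≤ n
  · have hp := of_mem_primitiveSpace_of_mem_primitiveForms hη (n := n) (by omega) hχ
    rw [LinearMap.compl₂_apply, LinearMap.compl₂_apply, ← lefschetzG_pow_of η j ha χ,
      L.andreHodgeInvolution_apply_pow_primitive_eq_smul_hodgeInvolution isZGrading_countingG d hp hj, map_smul, smul_eq_mul]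
  · rw [lefschetzPow_eq_zero_of_mem_primitiveForms (show m + n = finrank ℂ E by omega) (not_le.1 hj) ha hχ, GForm.of_zero, map_zero, map_zero, mul_zero]

omit [Fintype ι] in
/-- **`K_∗ = (−1)^{m(m+1)/2} · K_L` ON THE SUMMAND `Lʲ Pᵐ`, IN THE SECOND VARIABLE** (normalisation `d = g`; `∗(Lʲχ) = (−1)^{m(m+1)/2} L^{n−j}χ = (−1)^{m(m+1)/2} *_L(Lʲχ)`).
[cite: Milne1999LefschetzClasses, §5 p. 664] [cite: Andre1996Motifs, §1.1 (p. 10, "involutions de Lefschetz et de Hodge")] -/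
theorem compl₂_hodgeInvolution_apply_of_eq_mul_compl₂_lefschetzInvolution_apply_of (e : Fin N ≃ ι) {g : ℕ} (hg : finrank ℂ E = g) {a j m n : ℕ}
    (hmn : m + n = g) (ha : 2 * j + m = a) {y : E [⋀^Fin a]→L[ℝ] ℂ} (hy : y ∈ lefschetzSummandForms η a j) (w : GForm E ℂ) :
    (poincarePairingG Φ e).compl₂ ((hasLefschetzProperty_lefschetzG hη).hodgeInvolution isZGrading_countingG g) w (GForm.of a y) =
      (-1 : ℂ) ^ (m * (m + 1) / 2) *
        (poincarePairingG Φ e).compl₂ ((hasLefschetzProperty_lefschetzG hη).lefschetzInvolution isZGrading_countingG) w (GForm.of a y) := by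
  set L := hasLefschetzProperty_lefschetzG hη with hL
  rw [lefschetzSummandForms_eq η ha] at hy
  obtain ⟨χ, hχ, rfl⟩ := hy
  by_cases hj : j ≤ n
  · have hp := of_mem_primitiveSpace_of_mem_primitiveForms hη (n := n) (by omega) hχ
    rw [LinearMap.compl₂_apply, LinearMap.compl₂_apply, ← lefschetzG_pow_of η j ha χ, L.hodgeInvolution_apply_pow_primitive isZGrading_countingG g hp hj,
      L.isStringReversal_lefschetzInvolution isZGrading_countingG hp hj, map_smul, smul_eq_mul, show g - n = m by omega]
  · rw [lefschetzPow_eq_zero_of_mem_primitiveForms (show m + n = finrank ℂ E by omega) (not_le.1 hj) ha hχ, GForm.of_zero, map_zero, map_zero, mul_zero]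

omit [Fintype ι] in
/-- **`K_H = (−1)^{m(m+1)/2} (j!/(n−j)!) · K_L` ON THE SUMMAND `Lʲ Pᵐ`, IN THE SECOND VARIABLE: `K_H(w, of a y) = (−1)^{m(m+1)/2}(j!/(n−j)!) K_L(w, of a y)`** for `y ∈ Lʲ Pᵐ`
(`m + n = g`, `a = m + 2j`, normalisation `d = g`), every `w`. [cite: Andre1996Motifs, §1.1 (p. 10, the formulas for `*_L` and `*_H`)] [cite: Kleiman1968AlgebraicCycles, §1.4] -/
theorem compl₂_andreHodgeInvolution_apply_of_eq_mul_compl₂_lefschetzInvolution_apply_of (e : Fin N ≃ ι) {g : ℕ} (hg : finrank ℂ E = g) {a j m n : ℕ}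
    (hmn : m + n = g) (ha : 2 * j + m = a) {y : E [⋀^Fin a]→L[ℝ] ℂ} (hy : y ∈ lefschetzSummandForms η a j) (w : GForm E ℂ) :
    (poincarePairingG Φ e).compl₂ ((hasLefschetzProperty_lefschetzG hη).andreHodgeInvolution isZGrading_countingG g) w (GForm.of a y) =
      ((-1 : ℂ) ^ (m * (m + 1) / 2) * ((j ! : ℕ) : ℂ) * (((n - j) ! : ℕ) : ℂ)⁻¹) *
        (poincarePairingG Φ e).compl₂ ((hasLefschetzProperty_lefschetzG hη).lefschetzInvolution isZGrading_countingG) w (GForm.of a y) := by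
  rw [compl₂_andreHodgeInvolution_apply_of_eq_mul_compl₂_hodgeInvolution_apply_of Φ hη e g hg hmn ha hy,
    compl₂_hodgeInvolution_apply_of_eq_mul_compl₂_lefschetzInvolution_apply_of Φ hη e hg hmn ha hy]
  ring

end Lefschetz

/-! ## §5 `K_H` pairs `H^{p,q}` with `H^{q,p}` only -/

section Types

omit [Fintype ι] [DecidableEq ι] [Nontrivial E] in
/-- No non-zero forms of type `(p, q)` with `p > g` or `q > g`. [cite: VoisinHodgeI2002, §2.3.1 (2.4)] -/
private theorem eq_zero_of_mem_typeSubmodule_of_finrank_lt₅₁ {k p q : ℕ} (hpq : p + q = k) {y : E [⋀^Fin k]→L[ℝ] ℂ}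
    (hy : y ∈ typeSubmodule E k p q) (h : finrank ℂ E < p ∨ finrank ℂ E < q) : y = 0 := by
  have hT := isOfTypeAt_of_mem_typeSubmodule hpq hy
  rcases h with h | h
  · exact hT.eq_zero_of_finrank_lt_fst h
  · have h1 := (isOfTypeAt_conjForm hT).eq_zero_of_finrank_lt_fst h
    rw [← conj_conj y, h1]
    ext v
    simp

/-- **`K_H` PAIRS `H^{p,q}` WITH `H^{q,p}` ONLY: `K_H(of k x, of k y) = 0` for `x ∈ H^{p,q} ∩ Hᵏ`, `y ∈ H^{p',q'} ∩ Hᵏ` with `p' ≠ q`** (`η` of type `(1,1)` and non-degenerate,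
normalisation `d = g`): `*_H y ∈ H^{g−q',g−p'}` (row g49-#3) and the cup product of types `(p, q)`, `(g−q', g−p')` in complementary degrees vanishes unless `p' = q`. On the REAL
classes of type `(p, p)` the form `K_H(x, y) = K_H(x, ȳ)` is André's Hermitian-type pairing. [cite: Andre1996Motifs, §1.1 Remarque (p. 11)] [cite: VoisinHodgeI2002, §7.3.2 Lemma 7.30] -/
theorem compl₂_andreHodgeInvolution_of_of_eq_zero_of_mem_typeSubmodule (h11 : ∀ u v : E, η ![Complex.I • u, Complex.I • v] = η ![u, v])
    (hη : ∀ v : E, v ≠ 0 → ∃ w : E, η ![v, w] ≠ 0) (e : Fin N ≃ ι) {k p q p' q' : ℕ} (hpq : p + q = k) (hpq' : p' + q' = k) (hne : p' ≠ q)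
    {x y : E [⋀^Fin k]→L[ℝ] ℂ} (hx : x ∈ typeSubmodule E k p q) (hy : y ∈ typeSubmodule E k p' q') :
    (poincarePairingG Φ e).compl₂ ((hasLefschetzProperty_lefschetzG hη).andreHodgeInvolution isZGrading_countingG (finrank ℂ E)) (GForm.of k x)
      (GForm.of k y) = 0 := by
  have hN := finrank_complex_mul_two Φ e
  by_cases hbig : finrank ℂ E < p' ∨ finrank ℂ E < q'
  · rw [eq_zero_of_mem_typeSubmodule_of_finrank_lt₅₁ hpq' hy hbig, GForm.of_zero, map_zero]
  · push Not at hbig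
    have hkm : k + (2 * finrank ℂ E - k) = 2 * finrank ℂ E := by omega
    rw [compl₂_andreHodgeInvolution_of_of Φ hη e _ (show k + (2 * finrank ℂ E - k) = N by omega)]
    have hsy := andreHodgeInvolution_of_apply_mem_typeSubmodule hη h11 rfl hkm hpq' (p' := finrank ℂ E - q') (q' := finrank ℂ E - p') (by omega)
      (by omega) hy
    exact poincarePairing_eq_zero_of_isOfTypeAt_of_add_ne Φ e _ (isOfTypeAt_of_mem_typeSubmodule hpq hx)
      (isOfTypeAt_of_mem_typeSubmodule (by omega) hsy) (by omega)

end Types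

/-! ## §6 André's positivity: `sign_X(e)(−1)^g K_H(x, x) > 0` on the non-zero real `(p,p)`-classes; anisotropy on `Hdgᵖ(X)`; the signs of `K_∗`, `K_L` on `Lʲ Pᵐ` -/

section Positivity

/-- **ANDRÉ'S POSITIVITY FOR `K_H` ("cet opérateur star et `*_H` ont les mêmes propriétés de positivité sur les cycles réels de type `(p,p)`"), in the tree's orientation:
`sign_X(e) · (−1)^g · K_H(of x, of x) = c > 0`** for every non-zero REAL class `x` of type `(p, p)` — EVERY `p` (for `2p > 2g` there is no such `x`) —, `η` positive of
type `(1,1)` and non-degenerate (a Kähler datum): `K_H(of x, of x) = sign_X(e) ∫_X x ∧ *_H x` (§1) and `(−1)^g ∫_X x ∧ *_H x > 0` (row g49-#3, from the Hodge–Riemann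
bilinear relations for the Weyl pairing). The sign `(−1)^g` is the tree's orientation convention (`∫_X η^{∧g} = (−1)^g g! d₁⋯d_g`, `c₁ = −Im H`).
[cite: Andre1996Motifs, §1.1 Remarque (p. 11)] [cite: VoisinHodgeI2002, §6.3.2 Thm. 6.32] [cite: Lange2023AbelianVarietiesComplex, §1.7.2 Lemmas 1.7.4–1.7.5] -/
theorem exists_pos_orientationSign_mul_compl₂_andreHodgeInvolution_of_of_self (h11 : ∀ u v : E, η ![Complex.I • u, Complex.I • v] = η ![u, v])
    (hpos : ∀ u : E, u ≠ 0 → 0 < η ![Complex.I • u, u]) (hη : ∀ v : E, v ≠ 0 → ∃ w : E, η ![v, w] ≠ 0) {g : ℕ} (e : Fin (2 * g) ≃ ι) {p : ℕ}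
    {x : E [⋀^Fin (2 * p)]→L[ℝ] ℂ} (hx : x ∈ typeSubmodule E (2 * p) p p) (hreal : conjForm x = x) (hx0 : x ≠ 0) :
    ∃ c : ℝ, 0 < c ∧
      orientationSign Φ e * (-1) ^ g *
          (poincarePairingG Φ e).compl₂ ((hasLefschetzProperty_lefschetzG hη).andreHodgeInvolution isZGrading_countingG g) (GForm.of (2 * p) x) (GForm.of (2 * p) x) =
        c := by
  have hg : finrank ℂ E = g := finrank_eq_of_finTwoMulEquiv Φ e
  by_cases hp : 2 * p ≤ 2 * g
  swap
  · exact absurd (eq_zero_of_finrank_real_lt x (by rw [finrank_real_of_complex]; omega)) hx0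
  obtain ⟨c, hc, hcx⟩ := exists_pos_neg_one_pow_mul_torusIntegral_wedge_andreHodgeInvolution Φ h11 hpos hη e (t := 2 * g - 2 * p) (by omega) (by omega)
    hx hreal hx0
  refine ⟨c, hc, ?_⟩
  rw [← hcx, compl₂_andreHodgeInvolution_of_of_eq_orientationSign_mul_torusIntegral Φ hη e g (show 2 * p + (2 * g - 2 * p) = 2 * g by omega),
    mul_comm (orientationSign Φ e : ℂ) ((-1) ^ g), mul_assoc, ← mul_assoc (orientationSign Φ e : ℂ) (orientationSign Φ e : ℂ),
    orientationSign_mul_self_complex₅₁, one_mul]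

/-- **`K_H` IS ANISOTROPIC ON THE REAL `(p,p)`-CLASSES: `K_H(of x, of x) = 0 ↔ x = 0`** for `x` real of type `(p, p)` (`η` a Kähler datum). [cite: Andre1996Motifs, §1.1 Remarque (p. 11)]
[cite: Kleiman1968AlgebraicCycles, §3 (Hodge index)] -/
theorem compl₂_andreHodgeInvolution_of_of_self_eq_zero_iff (h11 : ∀ u v : E, η ![Complex.I • u, Complex.I • v] = η ![u, v])
    (hpos : ∀ u : E, u ≠ 0 → 0 < η ![Complex.I • u, u]) (hη : ∀ v : E, v ≠ 0 → ∃ w : E, η ![v, w] ≠ 0) {g : ℕ} (e : Fin (2 * g) ≃ ι) {p : ℕ}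
    {x : E [⋀^Fin (2 * p)]→L[ℝ] ℂ} (hx : x ∈ typeSubmodule E (2 * p) p p) (hreal : conjForm x = x) :
    (poincarePairingG Φ e).compl₂ ((hasLefschetzProperty_lefschetzG hη).andreHodgeInvolution isZGrading_countingG g) (GForm.of (2 * p) x) (GForm.of (2 * p) x) = 0 ↔
      x = 0 := by
  refine ⟨fun h0 ↦ by_contra fun hx0 ↦ ?_, fun h ↦ by rw [h, GForm.of_zero, map_zero]⟩
  obtain ⟨c, hc, hcx⟩ := exists_pos_orientationSign_mul_compl₂_andreHodgeInvolution_of_of_self Φ h11 hpos hη e hx hreal hx0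
  rw [h0, mul_zero] at hcx
  exact hc.ne' (by exact_mod_cast hcx.symm)

/-- **On a polarized complex torus** (`η` a Riemann form): `sign_X(e)(−1)^g K_H(of x, of x) = c > 0` for every non-zero real class `x` of type `(p, p)`.
[cite: Andre1996Motifs, §1.1 Remarque (p. 11)] [cite: Lange2023AbelianVarietiesComplex, §5.4.1 Lemma 5.4.3 (d)] -/
theorem IsRiemannForm.exists_pos_orientationSign_mul_compl₂_andreHodgeInvolution_of_of_self (hR : IsRiemannForm Φ η) {g : ℕ} (e : Fin (2 * g) ≃ ι) {p : ℕ}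
    {x : E [⋀^Fin (2 * p)]→L[ℝ] ℂ} (hx : x ∈ typeSubmodule E (2 * p) p p) (hreal : conjForm x = x) (hx0 : x ≠ 0) :
    ∃ c : ℝ, 0 < c ∧
      orientationSign Φ e * (-1) ^ g *
          (poincarePairingG Φ e).compl₂ ((hasLefschetzProperty_lefschetzG (hR.exists_apply_ne_zero Φ)).andreHodgeInvolution isZGrading_countingG g)
            (GForm.of (2 * p) x) (GForm.of (2 * p) x) = c :=
  ComplexTorus.exists_pos_orientationSign_mul_compl₂_andreHodgeInvolution_of_of_self Φ hR.1 hR.2.2 (hR.exists_apply_ne_zero Φ) e hx hreal hx0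

/-- **`K_H` ON THE HODGE CLASSES OF A POLARIZED TORUS TAKES POSITIVE RATIONAL VALUES ON THE DIAGONAL, UP TO THE SIGN `sign_X(e)(−1)^g`:
`sign_X(e)(−1)^g K_H(of x, of x) = q ∈ ℚ_{>0}`** for every `0 ≠ x ∈ Hdgᵖ(X)` (rational classes are real — `conjForm x = x` —, of type `(p,p)`; `K_H` is `ℚ`-valued, §3).
[cite: Andre1996Motifs, §1.1 Remarque (p. 11)] [cite: Lange2023AbelianVarietiesComplex, §7.2.2] [cite: Kleiman1968AlgebraicCycles, §3] -/
theorem IsRiemannForm.exists_pos_rat_orientationSign_mul_compl₂_andreHodgeInvolution_of_mem_hodgeClasses (hR : IsRiemannForm Φ η) {g : ℕ}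
    (e : Fin (2 * g) ≃ ι) {p : ℕ} {x : E [⋀^Fin (2 * p)]→L[ℝ] ℂ} (hx : x ∈ hodgeClasses Φ p) (hx0 : x ≠ 0) :
    ∃ q : ℚ, 0 < q ∧
      orientationSign Φ e * (-1) ^ g *
          (poincarePairingG Φ e).compl₂ ((hasLefschetzProperty_lefschetzG (hR.exists_apply_ne_zero Φ)).andreHodgeInvolution isZGrading_countingG g)
            (GForm.of (2 * p) x) (GForm.of (2 * p) x) = q := by
  have hg : finrank ℂ E = g := finrank_eq_of_finTwoMulEquiv Φ e
  obtain ⟨c, hc, hcx⟩ := hR.exists_pos_orientationSign_mul_compl₂_andreHodgeInvolution_of_of_self Φ e hx.2 (conjForm_eq_self_of_mem_rationalForms Φ hx.1) hx0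
  obtain ⟨q₀, hq₀⟩ := compl₂_andreHodgeInvolution_of_of_mem_range_rat_of_mem_hodgeClasses Φ (mem_neronSeveriQ_of_isNSForm Φ (hR.isNSForm Φ))
    (hR.exists_apply_ne_zero Φ) e hx hx
  rw [hg] at hq₀
  refine ⟨orientationSign Φ e * (-1) ^ g * q₀, ?_, by rw [hq₀]; push_cast; ring⟩
  have h1 : (((orientationSign Φ e * (-1) ^ g * q₀ : ℚ) : ℝ) : ℂ) = (c : ℂ) := by
    rw [Complex.ofReal_ratCast, ← hcx, hq₀]
    push_cast
    ring
  have h2 : ((orientationSign Φ e * (-1) ^ g * q₀ : ℚ) : ℝ) = c := Complex.ofReal_injective h1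
  exact_mod_cast h2 ▸ hc

/-- **`K_H` IS ANISOTROPIC ON `Hdgᵖ(X)` for a polarized torus: `K_H(of x, of x) = 0 ↔ x = 0` for `x ∈ Hdgᵖ(X)`** — in particular NON-DEGENERATE on the Hodge classes.
[cite: Andre1996Motifs, §1.1 Remarque (p. 11)] [cite: Kleiman1968AlgebraicCycles, §3] [cite: Lange2023AbelianVarietiesComplex, §7.2.2] -/
theorem IsRiemannForm.compl₂_andreHodgeInvolution_of_of_self_eq_zero_iff_of_mem_hodgeClasses (hR : IsRiemannForm Φ η) {g : ℕ} (e : Fin (2 * g) ≃ ι)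
    {p : ℕ} {x : E [⋀^Fin (2 * p)]→L[ℝ] ℂ} (hx : x ∈ hodgeClasses Φ p) :
    (poincarePairingG Φ e).compl₂ ((hasLefschetzProperty_lefschetzG (hR.exists_apply_ne_zero Φ)).andreHodgeInvolution isZGrading_countingG g)
        (GForm.of (2 * p) x) (GForm.of (2 * p) x) = 0 ↔ x = 0 :=
  compl₂_andreHodgeInvolution_of_of_self_eq_zero_iff Φ hR.1 hR.2.2 (hR.exists_apply_ne_zero Φ) e hx.2 (conjForm_eq_self_of_mem_rationalForms Φ hx.1)

/-- **KLEIMAN'S `∗` HAS ANDRÉ'S SIGN, SUMMAND BY SUMMAND: `sign_X(e)(−1)^g K_∗(of x, of x) = c > 0`** for every non-zero real class `x` of type `(p, p)` IN ONE LEFSCHETZ SUMMAND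
`Lʲ P^{2p−2j}` (Milne's range `2p ≤ g + j`; normalisation `d = g`): there `K_H = (j!/(n−j)!) K_∗` with `j!/(n−j)! > 0` (§4). [cite: Andre1996Motifs, §1.1 Remarque (p. 11)]
[cite: Kleiman1968AlgebraicCycles, §1.4 and §3] [cite: Milne1999LefschetzClasses, §5 p. 664] -/
theorem exists_pos_orientationSign_mul_compl₂_hodgeInvolution_of_of_self_of_mem_lefschetzSummandForms
    (h11 : ∀ u v : E, η ![Complex.I • u, Complex.I • v] = η ![u, v]) (hpos : ∀ u : E, u ≠ 0 → 0 < η ![Complex.I • u, u])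
    (hη : ∀ v : E, v ≠ 0 → ∃ w : E, η ![v, w] ≠ 0) {g : ℕ} (e : Fin (2 * g) ≃ ι) {p j : ℕ} (hpj : 2 * p ≤ g + j) {x : E [⋀^Fin (2 * p)]→L[ℝ] ℂ}
    (hxL : x ∈ lefschetzSummandForms η (2 * p) j) (hx : x ∈ typeSubmodule E (2 * p) p p) (hreal : conjForm x = x) (hx0 : x ≠ 0) :
    ∃ c : ℝ, 0 < c ∧
      orientationSign Φ e * (-1) ^ g *
          (poincarePairingG Φ e).compl₂ ((hasLefschetzProperty_lefschetzG hη).hodgeInvolution isZGrading_countingG g) (GForm.of (2 * p) x) (GForm.of (2 * p) x) =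
        c := by
  have hg : finrank ℂ E = g := finrank_eq_of_finTwoMulEquiv Φ e
  by_cases h2j : 2 * j ≤ 2 * p
  swap
  · exact absurd (eq_zero_of_mem_lefschetzSummandForms η (by omega) hxL) hx0
  obtain ⟨c, hc, hcx⟩ := exists_pos_orientationSign_mul_compl₂_andreHodgeInvolution_of_of_self Φ h11 hpos hη e hx hreal hx0
  have hK := compl₂_andreHodgeInvolution_apply_of_eq_mul_compl₂_hodgeInvolution_apply_of Φ hη e g hg (m := 2 * (p - j)) (n := g + 2 * j - 2 * p)
    (by omega) (show 2 * j + 2 * (p - j) = 2 * p by omega) hxL (GForm.of (2 * p) x)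
  have hj0 : ((j ! : ℕ) : ℂ) ≠ 0 := by exact_mod_cast (Nat.factorial_pos j).ne'
  have hnj0 : (((g + 2 * j - 2 * p - j) ! : ℕ) : ℂ) ≠ 0 := by exact_mod_cast (Nat.factorial_pos _).ne'
  refine ⟨c * ((g + 2 * j - 2 * p - j) ! : ℕ) / (j ! : ℕ), by positivity, ?_⟩
  push_cast
  rw [← hcx, hK]
  field_simp

/-- **THE SIGN OF `B(x, *_L x)` ALTERNATES WITH THE LEFSCHETZ POSITION: `sign_X(e)(−1)^{g+p+j} K_L(of x, of x) = c > 0`** for every non-zero real class `x` of type `(p, p)` in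
the summand `Lʲ P^{2p−2j}` (Milne's range `2p ≤ g + j`): there `K_H = (−1)^{(p−j)(2p−2j+1)}(j!/(n−j)!) K_L = (−1)^{p−j}(j!/(n−j)!) K_L` (§4), so André's positivity of `K_H` reads
as a sign `(−1)^{p+j}` for `K_L` — "l'intérêt de l'introduction de `*_H`" over `*_L`. [cite: Andre1996Motifs, §1.1 Remarque (p. 11)] [cite: Kleiman1968AlgebraicCycles, §1.4 and §3]
[cite: VoisinHodgeI2002, §6.3.2 Thm. 6.32] -/
theorem exists_pos_orientationSign_mul_compl₂_lefschetzInvolution_of_of_self_of_mem_lefschetzSummandForms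
    (h11 : ∀ u v : E, η ![Complex.I • u, Complex.I • v] = η ![u, v]) (hpos : ∀ u : E, u ≠ 0 → 0 < η ![Complex.I • u, u])
    (hη : ∀ v : E, v ≠ 0 → ∃ w : E, η ![v, w] ≠ 0) {g : ℕ} (e : Fin (2 * g) ≃ ι) {p j : ℕ} (hpj : 2 * p ≤ g + j) {x : E [⋀^Fin (2 * p)]→L[ℝ] ℂ}
    (hxL : x ∈ lefschetzSummandForms η (2 * p) j) (hx : x ∈ typeSubmodule E (2 * p) p p) (hreal : conjForm x = x) (hx0 : x ≠ 0) :
    ∃ c : ℝ, 0 < c ∧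
      orientationSign Φ e * (-1) ^ (g + p + j) *
          (poincarePairingG Φ e).compl₂ ((hasLefschetzProperty_lefschetzG hη).lefschetzInvolution isZGrading_countingG) (GForm.of (2 * p) x) (GForm.of (2 * p) x) =
        c := by
  have hg : finrank ℂ E = g := finrank_eq_of_finTwoMulEquiv Φ e
  by_cases h2j : 2 * j ≤ 2 * p
  swap
  · exact absurd (eq_zero_of_mem_lefschetzSummandForms η (by omega) hxL) hx0
  obtain ⟨c, hc, hcx⟩ := exists_pos_orientationSign_mul_compl₂_andreHodgeInvolution_of_of_self Φ h11 hpos hη e hx hreal hx0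
  have hK := compl₂_andreHodgeInvolution_apply_of_eq_mul_compl₂_lefschetzInvolution_apply_of Φ hη e hg (m := 2 * (p - j)) (n := g + 2 * j - 2 * p)
    (by omega) (show 2 * j + 2 * (p - j) = 2 * p by omega) hxL (GForm.of (2 * p) x)
  rw [neg_one_pow_two_mul_mul_succ_div_two₅₁] at hK
  have hj0 : ((j ! : ℕ) : ℂ) ≠ 0 := by exact_mod_cast (Nat.factorial_pos j).ne'
  have hnj0 : (((g + 2 * j - 2 * p - j) ! : ℕ) : ℂ) ≠ 0 := by exact_mod_cast (Nat.factorial_pos _).ne'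
  have hsign : (-1 : ℂ) ^ (g + p + j) = (-1) ^ g * (-1) ^ (p - j) := by
    rw [add_assoc, pow_add, neg_one_pow_eq_of_add_eq_two_mul₅₁ (show (p - j) + (p + j) = 2 * p by omega)]
  refine ⟨c * ((g + 2 * j - 2 * p - j) ! : ℕ) / (j ! : ℕ), by positivity, ?_⟩
  push_cast
  rw [← hcx, hK, hsign]
  field_simp

end Positivity

end ComplexTorus

end Literature.Geometry.Kaehler
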